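import Summits.HodgeConjecture.HodgeConjecture.Theorems.LimitExtensionMiddleDivisorSupportSuffices
import Literature.AlgebraicGeometry.HodgeTheory.PencilStepBelowMiddle

/-!
# Route LimitExtension · `MiddleDivisorSupportSuffices` (stmt-HodgeConjecture-10865):
# the pencil-step fact is equivalent to the body of `PencilReduction`

Helper file (`--supports stmt-HodgeConjecture-10865`). The item is closed modulo three named
facts by `middleDivisorSupportSuffices_of_leaves`
(`Theorems/LimitExtensionMiddleDivisorSupportSufficesOfPencilStep`): Hodge III Prop. 8.2.7, the
polarizability of the Hodge structure of a smooth projective variety, and the LEFSCHETZ-PENCIL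
STEP below the middle,
`Literature.AlgebraicGeometry.HodgeTheory.deCataldoMigliorini2009_mem_algebraicClasses_of_two_mul_le`
(de Cataldo–Migliorini 2009, proof of Prop. 4.5; Thomas 2005, proof of Prop. 2). The same step is
filed route-side as the support item `PencilReduction` of routes `NodalSupport` /
`LinearSystemTorelli` (stmt-HodgeConjecture-1083) — verbatim the hypothesis `hPen` of this
directory's assembly induction `middleDivisorSupportSuffices_of_facts` — whose body carries one
more antecedent (the Hodge conjecture in codimension `p − 1` on `(m+1)`-folds).
`pencilReduction_body_of_pencilStep` (`…OfPencilStep`) derives that body from the fact; here we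
prove the converse, `pencilStep_of_pencilReduction_body` — the extra antecedent is discharged by
an induction on the codimension `p` (codimension `0`: `algebraicClasses X 0 = ⊤`) — and record the
equivalence `pencilStep_iff_pencilReduction_body` (the easy direction re-proved inline, one line,
so that this file does not depend on `…OfPencilStep`). CONSEQUENCE for the debt queue: the
Literature fact and item stmt-HodgeConjecture-1083 are ONE obligation; whichever is discharged
first gives the other in one line, and either feeds the closing recipe of stmt-HodgeConjecture-10865:
`middleDivisorSupportSuffices_of_leaves h827 hpol (pencilStep_of_pencilReduction_body pen)` or
`middleDivisorSupportSuffices_of_facts hD hV pen`.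

## References

* [DecataldoMigliorini2009] M. A. de Cataldo, L. Migliorini, The Hodge theory of maps, §4,
  Prop. 4.5 and its proof (arXiv:0711.1307v1, pp. 10–11).
* [Thomas2005Nodes] R. P. Thomas, Nodes and the Hodge conjecture, J. Algebraic Geom. 14 (2005),
  §2, Prop. 2 and its proof.
-/

noncomputable section

-- the mandated namespace `Summit.HodgeConjecture.HodgeConjecture.Theorems` (Sub = Summit) trips
-- `linter.dupNamespace`; off tree-wide in the lakefile, restated for stand-alone elaboration.
set_option linter.dupNamespace false

open Literature.AlgebraicGeometry.Motives Literature.AlgebraicGeometry.HodgeTheory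

namespace Summit.HodgeConjecture.HodgeConjecture.Theorems

/-- **The body of `PencilReduction` (stmt-HodgeConjecture-1083) implies the pencil-step fact.**
If, for all `1 ≤ p` with `2p ≤ m`, the Hodge conjecture for smooth projective `m`-folds (all
codimensions) together with the Hodge conjecture in codimension `p − 1` for `(m+1)`-folds gives the
Hodge conjecture in codimension `p` for `(m+1)`-folds, then the Hodge conjecture for `m`-folds
alone gives it on `(m+1)`-folds in every codimension `p` with `2p ≤ m`: induction on `p`, the case
`p = 0` being `algebraicClasses X 0 = ⊤` (`hodgeConjectureFor_codim_zero`).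
[cite: DecataldoMigliorini2009, §4 proof of Prop. 4.5] [cite: Thomas2005Nodes, §2 proof of Prop. 2] -/
theorem pencilStep_of_pencilReduction_body
    (hPen : ∀ (m p : ℕ), 1 ≤ p → 2 * p ≤ m →
      (∀ ⦃Y : SchemeOver ℂ⦄, IsSmoothProjective m Y → ∀ (q : ℕ) (c : complexBetti Y (2 * q)),
        IsRationalClass c → IsOfHodgeType m Y (2 * q) q q c → c ∈ algebraicClasses Y q) →
      (∀ ⦃X' : SchemeOver ℂ⦄, IsSmoothProjective (m + 1) X' →
        ∀ c : complexBetti X' (2 * (p - 1)), IsRationalClass c →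
          IsOfHodgeType (m + 1) X' (2 * (p - 1)) (p - 1) (p - 1) c → c ∈ algebraicClasses X' (p - 1)) →
      ∀ ⦃X : SchemeOver ℂ⦄, IsSmoothProjective (m + 1) X → ∀ c : complexBetti X (2 * p),
        IsRationalClass c → IsOfHodgeType (m + 1) X (2 * p) p p c → c ∈ algebraicClasses X p) :
    Literature.AlgebraicGeometry.HodgeTheory.deCataldoMigliorini2009_mem_algebraicClasses_of_two_mul_le := by
  intro m X hX hHC p
  -- the conclusion for ALL smooth projective `(m+1)`-folds at once, by induction on `p`
  suffices h : ∀ p, 2 * p ≤ m → ∀ ⦃X : SchemeOver ℂ⦄, IsSmoothProjective (m + 1) X →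
      ∀ c : complexBetti X (2 * p), IsRationalClass c → IsOfHodgeType (m + 1) X (2 * p) p p c →
        c ∈ algebraicClasses X p from
    fun c hpm hc hH ↦ h p hpm hX c hc hH
  intro p
  induction p with
  | zero => exact fun _ X _ c _ _ ↦ hodgeConjectureFor_codim_zero c
  | succ p' ih =>
    intro hpm X hX c hc hH
    exact hPen m (p' + 1) (Nat.succ_pos p') hpm hHC
      (fun X' hX' c' hc' hH' ↦ ih (by omega) hX' c' hc' hH') hX c hc hH

/-- **The pencil-step fact and the body of `PencilReduction` (stmt-HodgeConjecture-1083) are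
equivalent.** Forward: the fact supplies the body with its codimension-`(p − 1)` antecedent simply
dropped (as in `pencilReduction_body_of_pencilStep`); backward: `pencilStep_of_pencilReduction_body`.
[cite: DecataldoMigliorini2009, §4 proof of Prop. 4.5] [cite: Thomas2005Nodes, §2 proof of Prop. 2] -/
theorem pencilStep_iff_pencilReduction_body :
    Literature.AlgebraicGeometry.HodgeTheory.deCataldoMigliorini2009_mem_algebraicClasses_of_two_mul_le ↔
    ∀ (m p : ℕ), 1 ≤ p → 2 * p ≤ m →
      (∀ ⦃Y : SchemeOver ℂ⦄, IsSmoothProjective m Y → ∀ (q : ℕ) (c : complexBetti Y (2 * q)),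
        IsRationalClass c → IsOfHodgeType m Y (2 * q) q q c → c ∈ algebraicClasses Y q) →
      (∀ ⦃X' : SchemeOver ℂ⦄, IsSmoothProjective (m + 1) X' →
        ∀ c : complexBetti X' (2 * (p - 1)), IsRationalClass c →
          IsOfHodgeType (m + 1) X' (2 * (p - 1)) (p - 1) (p - 1) c → c ∈ algebraicClasses X' (p - 1)) →
      ∀ ⦃X : SchemeOver ℂ⦄, IsSmoothProjective (m + 1) X → ∀ c : complexBetti X (2 * p),
        IsRationalClass c → IsOfHodgeType (m + 1) X (2 * p) p p c → c ∈ algebraicClasses X p :=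
  ⟨fun hP _m p _hp hpm hHC _ _X hX c hc hH ↦ hP hX hHC p c hpm hc hH,
    pencilStep_of_pencilReduction_body⟩

end Summit.HodgeConjecture.HodgeConjecture.Theorems

end
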